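/-
Copyright (c) 2026 the pub-hodgecm-mathlib formalisation cell (harness21).  Prover seat hodgecm-mathlib-A-p03 (g25); (R2)-EP road of line «N6nsGerm» (chair F0P3a-plan (g10),
EP pen B-p04 (g34) E-PLAN 08:23:16Z item (R4) «the interior-vertex count», offer-to-take A-p03 08:25:48Z), 2026-09-01.
-/
import Literature.NumberTheory.Automorphic.PlaneLatticesCompanionScalarReduction      -- ★ B-p08 `map_le_map_smul_one_iff` (+ ★ `map_span_range_transpose_eq_self_iff`)
import Literature.NumberTheory.Automorphic.HeckeTransversalGL                          -- ★ `IsIntegralMatrix`, `mem_glInt_of_isIntegralMatrix`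
import Literature.NumberTheory.Rogawski1990.UnitStableOrbitalIntegralHSideValue        -- ★ B-p10 (L5) at `w` (frame transport, `_zpow_smul_one_eq_sum_at`'s instance block)
import HarnessLib

/-!
# INTERIOR vertices of the fixed ball: the `γ`-stable self-dual lattices on which `γ` reduces to a SCALAR are the `γ″`-stable self-dual lattices,
# `γ″ = u₁·1 + sϖ⁻¹(γ − u₁·1)` of depth `N − 1`, and they number `Σ_{j ≤ N−1, j ≡ e} w(j)`
(Kottwitz, *Tamagawa numbers* (1988) §2; Flicker (1998) §6 p. 95 REMARK; Rogawski (1990) §4.9, §12.6)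

Topic `NumberTheory/Automorphic`; namespace `Literature.NumberTheory.Automorphic` (+ `….UnitaryGroup` for the CM place).  THEOREMS ONLY (no definition, no instance, no notation,
no named fact, no `sorry`); kernel lane.  Cell `pub/hodgecm-mathlib`, F0∕P3a, line «N6nsGerm», road (R2)-EP (Kottwitz's Euler–Poincaré function on the tree of `U(Φ₂)_v`),
EP pen B-p04 (g34)'s E-PLAN item **(R4)** — the input of his edge count `E(γ) = V(N) + q·V(N−1)` ((R5)): among the `γ`-fixed vertices `x ∈ Fix_K(γ)` those with
`k_x := (r x)⁻¹ γ (r x) ≡ u₁·1 (mod 𝔪)` (scalar reduction: ALL `q+1` edges at `x` are fixed) are counted here.  HONEST LABEL: HC_CM is proved only modulo the printed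
citations until rung 0 closes; nothing printed is asserted — elementary lattice algebra over ★ (L5).

THE TRICK (§1, any field with a valuative relation).  For `γ ∈ GL₂(F)`, `u₁ ∈ 𝒪`, a unit `s` and `ϖ ≠ 0` put `A := u₁•1 + (s ϖ⁻¹)•(↑γ − u₁•1)`.  If `det γ` and `det A`
are units then for every lattice `Λ = Λ(g)`:  **`Λ` is `γ`-stable with `(γ − u₁)Λ ≤ ϖΛ`  ⟺  `Λ` is `A`-stable** (`γ = u₁ + s⁻¹ϖ(A − u₁)`; an integral matrix of
unit determinant lies in `GL₂(𝒪)`) — **`setOf_selfDualStable_scalarReduction_eq`**: `{Λ ∈ S(H, γ) | (↑γ − u₁•1)•Λ ≤ ϖ•Λ} = S(H, A)` for every form `H`.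
For a type-(1) elliptic `γ` with eigenframe `γP = P·diag(u₀, u₁)`, `|u₀ − u₁| = |ϖ^N|`, `N ≥ 1`: `A P = P·diag(u″₀, u₁)` with `u″₀ = u₁ + sϖ⁻¹(u₀ − u₁)`,
`|u″₀ − u₁| = |ϖ^{N−1}|`, and `s ∈ {1, −1}` can be chosen with `u″₀` a unit (`2 ∈ 𝒪^×`) — so `A` is «`γ` one level up», in the SAME frame, and ★ (L5) counts `S(H, A)`.
§2 AT THE CM PLACE `w` (`v` unramified non-split, `(Φ₂)_w`, `σ_w`, `ϖ_w = ι_w(ϖ_v)`): **`exists_ncard_selfDualStable_scalarReduction_antidiagTwo_eq_sum_at`** —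
`∃ e ≤ 1, (Even (log|⟨p₀,p₀⟩|) ↔ e = 0) ∧ #{Λ ∈ S((Φ₂)_w, γ) | scalar reduction} = Σ_{j ≤ N−1, j % 2 = e} w(q_v, j)` (= `V_K(N−1)`, the SAME parity bit as ★ B-p10's
`V_K(N) = Σ_{j ≤ N, j % 2 = e} w`: the frame `P` and the rescaling `D` are `γ`'s — ★ `exists_rescaling_formCongr_eq_uniformizer_pow_smul_one`; the transport ★
`ncard_selfDualStable_congr` at `P·D` is `GL₂`-generic and `(PD)⁻¹A(PD) = diag(u″₀, u₁)`; ★ (L5-d3) `ncard_selfDualStable_smul_one_diag_eq_sum` needs only `|u″₀| = |u₁| = 1`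
and `|u″₀ − u₁| = |ϖ^{N−1}|`, no unitarity).  The ϖ-modular twin is one `rw` away (★ `setOf_modularStable_eq_selfDualStable`).

## References
* [Kottwitz1988] R. E. Kottwitz, *Tamagawa numbers*, Ann. of Math. 127 (1988) 629–646: §2.
* [Flicker1998UnitaryFL] Y. Z. Flicker, *Elementary proof of the fundamental lemma for a unitary group*, Canad. J. Math. 50 (1998): §4 Lemma I.I.1 p. 84, §6 p. 95 REMARK.
* [Rogawski1990] J. D. Rogawski, *Automorphic Representations of Unitary Groups in Three Variables* (1990): §4.9 Lemma 4.9.3 p. 61; §12.6 p. 174.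
* [Macdonald1995] I. G. Macdonald, *Symmetric functions and Hall polynomials* (1995), Ch. V §2.
-/

set_option autoImplicit false

noncomputable section

open scoped ValuativeRel Matrix MatrixGroups
open Matrix ValuativeRel Finset IsLocalRing NumberField IsDedekindDomain

namespace Literature.NumberTheory.Automorphic

variable {F : Type*} [Field F] [ValuativeRel F] (σ : F →+* F)

/-! ## §1 Scalar reduction of `γ` on `Λ` ⟺ `Λ` is stable under `A = u₁·1 + sϖ⁻¹(γ − u₁·1)` -/

section Generic

variable {n : ℕ}

omit [ValuativeRel F] in
/-- `g⁻¹ (u•1 + c•(γ − u•1)) g = u•1 + c•(g⁻¹ γ g − u•1)` (conjugation fixes scalars). [cite: Macdonald1995, Ch. V §2] -/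
theorem inv_mul_scalarShift_mul (g : GL (Fin n) F) (γ : Matrix (Fin n) (Fin n) F) (u c : F) :
    ((g⁻¹ : GL (Fin n) F) : Matrix (Fin n) (Fin n) F) * (u • (1 : Matrix (Fin n) (Fin n) F) + c • (γ - u • 1)) * (g : Matrix (Fin n) (Fin n) F) =
      u • (1 : Matrix (Fin n) (Fin n) F) + c • (((g⁻¹ : GL (Fin n) F) : Matrix (Fin n) (Fin n) F) * γ * (g : Matrix (Fin n) (Fin n) F) - u • 1) := by
  have hg : ((g⁻¹ : GL (Fin n) F) : Matrix (Fin n) (Fin n) F) * (g : Matrix (Fin n) (Fin n) F) = 1 := by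
    rw [← Units.val_mul, inv_mul_cancel, Units.val_one]
  rw [Matrix.mul_add, Matrix.add_mul, Matrix.mul_smul, Matrix.smul_mul, Matrix.mul_one, hg, Matrix.mul_smul, Matrix.smul_mul, Matrix.mul_sub, Matrix.sub_mul,
    Matrix.mul_smul, Matrix.smul_mul, Matrix.mul_one, hg]

/-- **SCALAR REDUCTION ⟺ `A`-STABILITY.**  `γ ∈ GL_n(F)` with `det γ` a unit, `u ∈ 𝒪`, `s` a unit, `ϖ ≠ 0`, `A := u•1 + (sϖ⁻¹)•(↑γ − u•1)` with `det A` a unit: a lattice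
`Λ(g)` is `γ`-stable with `(↑γ − u•1)•Λ(g) ≤ ϖ•Λ(g)` (i.e. `g⁻¹γg ≡ u·1 (mod 𝔪)`) iff `Λ(g)` is `A`-stable.  (⇒: `g⁻¹Ag = u + s·ϖ⁻¹g⁻¹(γ−u)g` is integral of unit
determinant; ⇐: `g⁻¹γg = u + s⁻¹ϖ(g⁻¹Ag − u)` likewise, and `ϖ⁻¹g⁻¹(γ−u)g = s⁻¹(g⁻¹Ag − u)` is integral.) [cite: Kottwitz1988, §2] [cite: Macdonald1995, Ch. V §2] -/
theorem map_eq_self_and_map_le_smul_iff_map_scalarShift_eq_self {ϖ u s : F} (hϖ0 : ϖ ≠ 0) (hu : u ∈ 𝒪[F]) (hs : valuation F s = 1) (hϖO : ϖ ∈ 𝒪[F])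
    (γ A : GL (Fin n) F) (hA : (A : Matrix (Fin n) (Fin n) F) = u • (1 : Matrix (Fin n) (Fin n) F) + (s * ϖ⁻¹) • ((γ : Matrix (Fin n) (Fin n) F) - u • 1))
    (hγdet : valuation F (γ : Matrix (Fin n) (Fin n) F).det = 1) (hAdet : valuation F (A : Matrix (Fin n) (Fin n) F).det = 1) (g : GL (Fin n) F) :
    ((Submodule.span 𝒪[F] (Set.range ((g : Matrix (Fin n) (Fin n) F))ᵀ)).map ((Matrix.toLin' (γ : Matrix (Fin n) (Fin n) F)).restrictScalars 𝒪[F]) =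
        Submodule.span 𝒪[F] (Set.range ((g : Matrix (Fin n) (Fin n) F))ᵀ) ∧
      (Submodule.span 𝒪[F] (Set.range ((g : Matrix (Fin n) (Fin n) F))ᵀ)).map
          ((Matrix.toLin' ((γ : Matrix (Fin n) (Fin n) F) - u • 1)).restrictScalars 𝒪[F]) ≤
        (Submodule.span 𝒪[F] (Set.range ((g : Matrix (Fin n) (Fin n) F))ᵀ)).map
          ((Matrix.toLin' (ϖ • (1 : Matrix (Fin n) (Fin n) F))).restrictScalars 𝒪[F])) ↔
      (Submodule.span 𝒪[F] (Set.range ((g : Matrix (Fin n) (Fin n) F))ᵀ)).map ((Matrix.toLin' (A : Matrix (Fin n) (Fin n) F)).restrictScalars 𝒪[F]) =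
        Submodule.span 𝒪[F] (Set.range ((g : Matrix (Fin n) (Fin n) F))ᵀ) := by
  have hs0 : s ≠ 0 := fun h => by rw [h, map_zero] at hs; exact zero_ne_one hs
  have hsO : s ∈ 𝒪[F] := (Valuation.mem_integer_iff _ _).2 hs.le
  have hsiO : s⁻¹ ∈ 𝒪[F] := (Valuation.mem_integer_iff _ _).2 (by rw [map_inv₀, hs, inv_one])
  rw [map_span_range_transpose_eq_self_iff, map_span_range_transpose_eq_self_iff, map_le_map_smul_one_iff g _ hϖ0]
  -- the two conjugates
  set B : Matrix (Fin n) (Fin n) F := ((g⁻¹ : GL (Fin n) F) : Matrix (Fin n) (Fin n) F) * (γ : Matrix (Fin n) (Fin n) F) * (g : Matrix (Fin n) (Fin n) F) with hB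
  have hBval : (((g⁻¹ * γ * g : GL (Fin n) F)) : Matrix (Fin n) (Fin n) F) = B := by rw [Units.val_mul, Units.val_mul]
  have hAval : (((g⁻¹ * A * g : GL (Fin n) F)) : Matrix (Fin n) (Fin n) F) = u • (1 : Matrix (Fin n) (Fin n) F) + (s * ϖ⁻¹) • (B - u • 1) := by
    rw [Units.val_mul, Units.val_mul, hA, inv_mul_scalarShift_mul]
  have hBdet : valuation F B.det = 1 := by rw [hB, Matrix.det_units_conj', hγdet]
  have hAdet' : valuation F (u • (1 : Matrix (Fin n) (Fin n) F) + (s * ϖ⁻¹) • (B - u • 1)).det = 1 := by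
    rw [← hAval, Units.val_mul, Units.val_mul, Matrix.det_units_conj', hAdet]
  have hconj : ((g⁻¹ : GL (Fin n) F) : Matrix (Fin n) (Fin n) F) * ((γ : Matrix (Fin n) (Fin n) F) - u • 1) * (g : Matrix (Fin n) (Fin n) F) = B - u • 1 := by
    have hg : ((g⁻¹ : GL (Fin n) F) : Matrix (Fin n) (Fin n) F) * (g : Matrix (Fin n) (Fin n) F) = 1 := by
      rw [← Units.val_mul, inv_mul_cancel, Units.val_one]
    rw [Matrix.mul_sub, Matrix.sub_mul, Matrix.mul_smul, Matrix.smul_mul, Matrix.mul_one, hg]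
  rw [hconj]
  constructor
  · rintro ⟨hγ, hsc⟩
    refine mem_glInt_of_isIntegralMatrix (fun i j => ?_) (by rw [hAval]; exact hAdet')
    rw [hAval, Matrix.add_apply, Matrix.smul_apply, Matrix.smul_apply, Matrix.one_apply, smul_eq_mul, smul_eq_mul, mul_assoc]
    refine (𝒪[F]).add_mem ((𝒪[F]).mul_mem hu ?_) ((𝒪[F]).mul_mem hsO ?_)
    · split_ifs
      · exact (𝒪[F]).one_mem
      · exact (𝒪[F]).zero_mem
    · have h := hsc i j
      rwa [Matrix.smul_apply, smul_eq_mul] at h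
  · intro hAst
    have hint : IsIntegralMatrix (u • (1 : Matrix (Fin n) (Fin n) F) + (s * ϖ⁻¹) • (B - u • 1)) := by
      rw [← hAval]; exact isIntegralMatrix_of_mem_glInt hAst
    -- `ϖ⁻¹ (B − u) = s⁻¹ (g⁻¹Ag − u)` is integral
    have hsc : ∀ i j, (ϖ⁻¹ • (B - u • (1 : Matrix (Fin n) (Fin n) F))) i j ∈ 𝒪[F] := by
      intro i j
      have h := hint i j
      rw [Matrix.add_apply, Matrix.smul_apply, Matrix.smul_apply, smul_eq_mul, smul_eq_mul] at h
      have h1 : u * (1 : Matrix (Fin n) (Fin n) F) i j ∈ 𝒪[F] := by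
        rw [Matrix.one_apply]; split_ifs
        · rw [mul_one]; exact hu
        · rw [mul_zero]; exact (𝒪[F]).zero_mem
      have h2 : s * ϖ⁻¹ * (B - u • 1) i j ∈ 𝒪[F] := by
        have := (𝒪[F]).sub_mem h h1; rwa [add_sub_cancel_left] at this
      have h3 := (𝒪[F]).mul_mem hsiO h2
      rw [Matrix.smul_apply, smul_eq_mul]
      rwa [← mul_assoc, ← mul_assoc, inv_mul_cancel₀ hs0, one_mul] at h3
    refine ⟨mem_glInt_of_isIntegralMatrix (fun i j => ?_) (by rw [hBval]; exact hBdet), hsc⟩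
    -- `B = u + ϖ · (ϖ⁻¹ (B − u))`
    rw [hBval]
    have hBe : B i j = u * (1 : Matrix (Fin n) (Fin n) F) i j + ϖ * ((ϖ⁻¹ • (B - u • (1 : Matrix (Fin n) (Fin n) F))) i j) := by
      rw [Matrix.smul_apply, smul_eq_mul, Matrix.sub_apply, Matrix.smul_apply, smul_eq_mul, ← mul_assoc, mul_inv_cancel₀ hϖ0, one_mul, add_sub_cancel]
    rw [hBe]
    refine (𝒪[F]).add_mem ?_ ((𝒪[F]).mul_mem hϖO (hsc i j))
    rw [Matrix.one_apply]; split_ifs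
    · rw [mul_one]; exact hu
    · rw [mul_zero]; exact (𝒪[F]).zero_mem

/-- **`{Λ ∈ S(H, γ) | (↑γ − u•1)•Λ ≤ ϖ•Λ} = S(H, A)`** as sets of lattices (the `γ`-stable self-dual lattices on which `γ` reduces to the scalar `u` mod `𝔪` are the
`A`-stable self-dual lattices, `A = u•1 + sϖ⁻¹(γ − u•1)`; hypotheses as in `map_eq_self_and_map_le_smul_iff_map_scalarShift_eq_self`).
[cite: Kottwitz1988, §2] [cite: Flicker1998UnitaryFL, §6 p. 95 REMARK] -/
theorem setOf_selfDualStable_scalarReduction_eq {ϖ u s : F} (hϖ0 : ϖ ≠ 0) (hu : u ∈ 𝒪[F]) (hs : valuation F s = 1) (hϖO : ϖ ∈ 𝒪[F])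
    (H : Matrix (Fin n) (Fin n) F) (γ A : GL (Fin n) F)
    (hA : (A : Matrix (Fin n) (Fin n) F) = u • (1 : Matrix (Fin n) (Fin n) F) + (s * ϖ⁻¹) • ((γ : Matrix (Fin n) (Fin n) F) - u • 1))
    (hγdet : valuation F (γ : Matrix (Fin n) (Fin n) F).det = 1) (hAdet : valuation F (A : Matrix (Fin n) (Fin n) F).det = 1) :
    {Λ : Submodule 𝒪[F] (Fin n → F) |
        ((∃ g : GL (Fin n) F, (∃ J' ∈ glInt n F, (J' : Matrix (Fin n) (Fin n) F) = formCongr σ g H) ∧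
            Λ = Submodule.span 𝒪[F] (Set.range ((g : Matrix (Fin n) (Fin n) F))ᵀ)) ∧
          Λ.map ((Matrix.toLin' ((γ : GL (Fin n) F) : Matrix (Fin n) (Fin n) F)).restrictScalars 𝒪[F]) = Λ) ∧
        Λ.map ((Matrix.toLin' (((γ : GL (Fin n) F) : Matrix (Fin n) (Fin n) F) - u • 1)).restrictScalars 𝒪[F]) ≤
          Λ.map ((Matrix.toLin' (ϖ • (1 : Matrix (Fin n) (Fin n) F))).restrictScalars 𝒪[F])} =
      {Λ : Submodule 𝒪[F] (Fin n → F) |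
        (∃ g : GL (Fin n) F, (∃ J' ∈ glInt n F, (J' : Matrix (Fin n) (Fin n) F) = formCongr σ g H) ∧
            Λ = Submodule.span 𝒪[F] (Set.range ((g : Matrix (Fin n) (Fin n) F))ᵀ)) ∧
          Λ.map ((Matrix.toLin' ((A : GL (Fin n) F) : Matrix (Fin n) (Fin n) F)).restrictScalars 𝒪[F]) = Λ} := by
  ext Λ
  simp only [Set.mem_setOf_eq]
  constructor
  · rintro ⟨⟨⟨g, hsd, rfl⟩, hst⟩, hsc⟩
    exact ⟨⟨g, hsd, rfl⟩, (map_eq_self_and_map_le_smul_iff_map_scalarShift_eq_self hϖ0 hu hs hϖO γ A hA hγdet hAdet g).1 ⟨hst, hsc⟩⟩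
  · rintro ⟨⟨g, hsd, rfl⟩, hst⟩
    have h := (map_eq_self_and_map_le_smul_iff_map_scalarShift_eq_self hϖ0 hu hs hϖO γ A hA hγdet hAdet g).2 hst
    exact ⟨⟨⟨g, hsd, rfl⟩, h.1⟩, h.2⟩

omit [ValuativeRel F] in
/-- **The shifted element has the SAME eigenframe**: `γP = P·diag(u)` ⟹ `(u₁•1 + c•(γ − u₁•1))·P = P·diag(fun i => u₁ + c(uᵢ − u₁))`.
[cite: Rogawski1990, §3.5 p. 29] -/
theorem scalarShift_mul_eigenframe {γ P : Matrix (Fin n) (Fin n) F} {u : Fin n → F} (hP : γ * P = P * diagonal u) (u₁ c : F) :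
    (u₁ • (1 : Matrix (Fin n) (Fin n) F) + c • (γ - u₁ • 1)) * P = P * diagonal (fun i => u₁ + c * (u i - u₁)) := by
  have hd : diagonal (fun i => u₁ + c * (u i - u₁)) = u₁ • (1 : Matrix (Fin n) (Fin n) F) + c • (diagonal u - u₁ • 1) := by
    ext i j
    simp only [Matrix.diagonal_apply, Matrix.add_apply, Matrix.smul_apply, Matrix.one_apply, Matrix.sub_apply, smul_eq_mul]
    split_ifs <;> ring
  rw [hd, Matrix.add_mul, Matrix.smul_mul, Matrix.one_mul, Matrix.smul_mul, Matrix.sub_mul, hP, Matrix.smul_mul, Matrix.one_mul, Matrix.mul_add, Matrix.mul_smul,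
    Matrix.mul_one, Matrix.mul_smul, Matrix.mul_sub, Matrix.mul_smul, Matrix.mul_one]

omit [ValuativeRel F] in
/-- `M P = P·diag(d)` with `P` invertible ⟹ `det M = d₀ d₁` (rank 2). [cite: Rogawski1990, §3.5 p. 29] -/
theorem det_eq_mul_of_mul_eigenframe_two {M : Matrix (Fin 2) (Fin 2) F} (P : GL (Fin 2) F) {d : Fin 2 → F}
    (h : M * (P : Matrix (Fin 2) (Fin 2) F) = (P : Matrix (Fin 2) (Fin 2) F) * diagonal d) : M.det = d 0 * d 1 := by
  have hPinv : (P : Matrix (Fin 2) (Fin 2) F) * ((P⁻¹ : GL (Fin 2) F) : Matrix (Fin 2) (Fin 2) F) = 1 := by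
    rw [← Units.val_mul, mul_inv_cancel, Units.val_one]
  have hM : M = (P : Matrix (Fin 2) (Fin 2) F) * diagonal d * ((P⁻¹ : GL (Fin 2) F) : Matrix (Fin 2) (Fin 2) F) := by
    rw [← h, Matrix.mul_assoc, hPinv, Matrix.mul_one]
  rw [hM, Matrix.det_units_conj, det_diagonal, Fin.prod_univ_two]

/-- **A unit `t ∈ {1, a, a′}` with `u + t c` a unit**, for units `u, a, a′` with `|a′ − a| = 1` and an integer `c` (ultrametric pigeonhole: if `u + c`, `u + a c`,
`u + a′ c` were all in `𝔪` then `(1 − a)c, (1 − a′)c ∈ 𝔪`, forcing `|c| = 1` and `a′ − a ∈ 𝔪`).  Used with `a′ = σ(a)` at an inert place, where such `a` exists.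
[cite: Serre1979, Ch. V §2] -/
theorem exists_valuation_add_mul_eq_one {u c a a' : F} (hu : valuation F u = 1) (hc : valuation F c ≤ 1) (ha : valuation F a = 1) (ha' : valuation F a' = 1)
    (haa' : valuation F (a' - a) = 1) : ∃ t : F, valuation F t = 1 ∧ valuation F (u + t * c) = 1 := by
  have hle_sum : ∀ t : F, valuation F t = 1 → valuation F (u + t * c) ≤ 1 := fun t ht =>
    le_trans (Valuation.map_add _ _ _) (max_le hu.le (by rw [map_mul, ht, one_mul]; exact hc))
  rcases eq_or_ne (valuation F (u + 1 * c)) 1 with h1 | h1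
  · exact ⟨1, map_one _, h1⟩
  rcases eq_or_ne (valuation F (u + a * c)) 1 with h2 | h2
  · exact ⟨a, ha, h2⟩
  refine ⟨a', ha', Classical.by_contradiction fun h3 => ?_⟩
  have lt1 := lt_of_le_of_ne (hle_sum 1 (map_one _)) h1
  have lt2 := lt_of_le_of_ne (hle_sum a ha) h2
  have lt3 := lt_of_le_of_ne (hle_sum a' ha') h3
  -- `|c| = 1` (else `|u + c| = 1`)
  have hcu : valuation F c = 1 := by
    rcases lt_or_ge (valuation F c) 1 with hclt | hcge
    · have : valuation F (u + 1 * c) = 1 := by rw [one_mul, Valuation.map_add_eq_of_lt_left _ (by rw [hu]; exact hclt), hu]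
      exact absurd this h1
    · exact le_antisymm hc hcge
  have hsmall : ∀ x y : F, valuation F (u + x * c) < 1 → valuation F (u + y * c) < 1 → valuation F (x - y) < 1 := by
    intro x y hx hy
    have h := lt_of_le_of_lt (Valuation.map_sub _ (u + x * c) (u + y * c)) (max_lt hx hy)
    rwa [show u + x * c - (u + y * c) = (x - y) * c by ring, map_mul, hcu, mul_one] at h
  have d1 := hsmall 1 a lt1 lt2
  have d2 := hsmall 1 a' lt1 lt3
  have h := lt_of_le_of_lt (Valuation.map_sub _ (1 - a) (1 - a')) (max_lt d1 d2)
  rw [show (1 : F) - a - (1 - a') = a' - a by ring, haa'] at h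
  exact lt_irrefl _ h

end Generic

/-! ## §2 At the CM place `w`: the interior-vertex count `V_K(N−1)` for a type-(1) elliptic `γ ∈ U(Φ₂)_v` -/

namespace UnitaryGroup

open Literature.NumberTheory.Rogawski1990 Literature.NumberTheory.GaloisRepresentations

section CM

variable (L : Type) [Field L] [NumberField L] [IsCMField L] (v : HeightOneSpectrum (𝓞 ↥(maximalRealSubfield L)))
  (w : PlacesOver L v) (hw : IsCMField.complexConj L • w.1 = w.1)

include hw in
/-- **B-p10's normalised count at `w` WITHOUT the norm-one hypothesis**: ★ `ncard_selfDualStable_zpow_smul_one_eq_sum_at` with `hu1 : σ_w(uᵢ)uᵢ = 1` weakened to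
`|uᵢ|_w = 1` (all ★ (L5-d3) uses) — needed for the shifted element `diag(u″₀, u₁)`, which is not unitary. [cite: Flicker1998UnitaryFL, §6 p. 95 REMARK] [cite: Serre1979, Ch. V §2 Prop. 3] -/
theorem ncard_selfDualStable_zpow_smul_one_eq_sum_at_of_valuation_eq_one (hunr : Algebra.IsUnramifiedIn (𝓞 L) v.asIdeal) {u : Fin 2 → w.1.adicCompletion L}
    (hval : ∀ i, valuation (w.1.adicCompletion L) (u i) = 1) {N : ℕ}
    (hN : valuation (w.1.adicCompletion L) (u 0 - u 1) =
      valuation (w.1.adicCompletion L) (toPlace v w (HeckeCharacter.uniformizer ↥(maximalRealSubfield L) v : v.adicCompletion ↥(maximalRealSubfield L)) ^ N))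
    {e : ℕ} (he : e ≤ 1) (γ' : GL (Fin 2) (w.1.adicCompletion L)) (hγ' : (γ' : Matrix (Fin 2) (Fin 2) (w.1.adicCompletion L)) = !![u 0, 0; 0, u 1]) :
    {Λ : Submodule 𝒪[w.1.adicCompletion L] (Fin 2 → w.1.adicCompletion L) |
        (∃ g : GL (Fin 2) (w.1.adicCompletion L),
          (∃ J' ∈ glInt 2 (w.1.adicCompletion L), (J' : Matrix (Fin 2) (Fin 2) (w.1.adicCompletion L)) =
            formCongr (galAdicCompletionMap (L := L) (IsCMField.complexConj L) hw) g
              ((toPlace v w (HeckeCharacter.uniformizer ↥(maximalRealSubfield L) v : v.adicCompletion ↥(maximalRealSubfield L)) ^ (e : ℤ)) •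
                (1 : Matrix (Fin 2) (Fin 2) (w.1.adicCompletion L)))) ∧
          Λ = Submodule.span 𝒪[w.1.adicCompletion L] (Set.range ((g : Matrix (Fin 2) (Fin 2) (w.1.adicCompletion L)))ᵀ)) ∧
        Λ.map ((Matrix.toLin' ((γ' : GL (Fin 2) (w.1.adicCompletion L)) : Matrix (Fin 2) (Fin 2) (w.1.adicCompletion L))).restrictScalars
          𝒪[w.1.adicCompletion L]) = Λ}.ncard =
      ∑ j ∈ (range (N + 1)).filter (fun j => j % 2 = e),
        (if j = 0 then 1 else Nat.card (𝓞 ↥(maximalRealSubfield L) ⧸ v.asIdeal) ^ (j - 1) * (Nat.card (𝓞 ↥(maximalRealSubfield L) ⧸ v.asIdeal) + 1)) := by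
  classical
  have hc1 : IsCMField.complexConj L ≠ 1 := IsCMField.complexConj_ne_one L
  have hϖv := Liu2021.LemD1IndexedNonVacuityInertCofinite.valued_toPlace_uniformizer_of_isUnramifiedIn L v hunr w
  have hϖ : IsUniformizingElement
      (toPlace v w (HeckeCharacter.uniformizer ↥(maximalRealSubfield L) v : v.adicCompletion ↥(maximalRealSubfield L))) :=
    isUniformizingElement_of_v_eq hϖv
  haveI : IsDiscreteValuationRing 𝒪[w.1.adicCompletion L] := isDiscreteValuationRing_integer_of_compatible hϖv
  have hσO : ∀ x : 𝒪[w.1.adicCompletion L], galAdicCompletionMap (L := L) (IsCMField.complexConj L) hw x ∈ 𝒪[w.1.adicCompletion L] :=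
    mem_integer_galAdicCompletionMap (IsCMField.complexConj L) v w hw
  let σO : 𝒪[w.1.adicCompletion L] →+* 𝒪[w.1.adicCompletion L] :=
    ((galAdicCompletionMap (L := L) (IsCMField.complexConj L) hw).comp (𝒪[w.1.adicCompletion L]).subtype).codRestrict 𝒪[w.1.adicCompletion L] fun x => hσO x
  have hσO' : ∀ x : 𝒪[w.1.adicCompletion L], ((σO x : 𝒪[w.1.adicCompletion L]) : w.1.adicCompletion L) =
      galAdicCompletionMap (L := L) (IsCMField.complexConj L) hw x := fun _ => rfl
  have hσσ : ∀ x, σO (σO x) = x := fun x => Subtype.ext (galAdicCompletionMap_galAdicCompletionMap_of_smul_eq (IsCMField.complexConj L) w hc1 hw (x : w.1.adicCompletion L))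
  have hσϖ : galAdicCompletionMap (L := L) (IsCMField.complexConj L) hw
      (toPlace v w (HeckeCharacter.uniformizer ↥(maximalRealSubfield L) v : v.adicCompletion ↥(maximalRealSubfield L))) =
      toPlace v w (HeckeCharacter.uniformizer ↥(maximalRealSubfield L) v : v.adicCompletion ↥(maximalRealSubfield L)) :=
    galAdicCompletionMap_toPlace (IsCMField.complexConj L) w w hw _
  obtain ⟨σk, hσk⟩ := exists_residueField_ringHom_galAdicCompletionMap (IsCMField.complexConj L) v w hw
  have hq : Nat.card 𝓀[w.1.adicCompletion L] = Nat.card (𝓞 ↥(maximalRealSubfield L) ⧸ v.asIdeal) ^ 2 :=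
    natCard_residueField_eq_sq_of_inert (IsCMField.complexConj L) v hc1 hunr w hw
  letI : Fintype 𝓀[w.1.adicCompletion L] := Fintype.ofFinite _
  have hq' : Fintype.card 𝓀[w.1.adicCompletion L] = Nat.card (𝓞 ↥(maximalRealSubfield L) ⧸ v.asIdeal) ^ 2 := by rw [← Nat.card_eq_fintype_card, hq]
  obtain ⟨a₀, ha₀⟩ := LocalFields.UnramifiedQuadraticNorm.exists_isUnit_map_sub_of_residueHom_ne
    (galAdicCompletionMap (L := L) (IsCMField.complexConj L) hw) hσO σk hσk
    (Literature.LinearAlgebra.Matrix.exists_frob_ne hq' σk (residueHom_galAdicCompletionMap_eq_pow (IsCMField.complexConj L) v hc1 hunr w hw σk hσO hσk))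
  have ha₀' : IsUnit (σO a₀ - a₀) := ha₀
  exact ncard_selfDualStable_smul_one_diag_eq_sum hϖ σO hσO' hσσ hσϖ he γ' hγ' (hval 0) (hval 1) hN ha₀' hq

omit [IsCMField L] in
/-- `diagonal u = !![u₀, 0; 0, u₁]` (matrix bookkeeping). [folklore] -/
private theorem diagonal_eq_fin_two'' (u : Fin 2 → w.1.adicCompletion L) :
    (diagonal u : Matrix (Fin 2) (Fin 2) (w.1.adicCompletion L)) = !![u 0, 0; 0, u 1] := by
  ext i j
  fin_cases i <;> fin_cases j <;> simp

set_option maxHeartbeats 400000 in  -- many valuation∕matrix rewrites over `L_w`: each is cheap, the sum is not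
include hw in
/-- **(R4) THE INTERIOR-VERTEX COUNT, type (1), at `w`**: for `γ ∈ U(σ_w, (Φ₂)_w)(L_w)` with an eigenframe `γ P = P·diag(u)`, `u₀ ≠ u₁` of norm one, `|u₀ − u₁|_w = |ϖ^N|`,
`N ≥ 1`: there is `e ∈ {0, 1}` — the SAME parity bit as ★ `exists_ncard_selfDualStable_antidiagTwo_eq_zpow_smul_one` (`Even (log|⟨p₀,p₀⟩|) ↔ e = 0`) — with
`#{Λ ∈ S((Φ₂)_w, γ) | (↑γ − u₁•1)•Λ ≤ ϖ_w•Λ} = Σ_{j ≤ N−1, j % 2 = e} w(q_v, j)` — the `γ`-fixed SELF-DUAL vertices at which `γ` reduces to a scalar (all `q_v + 1` edges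
fixed) are the fixed self-dual vertices of the ball of radius `N − 1`: `V_K(N−1)`.  [cite: Kottwitz1988, §2] [cite: Flicker1998UnitaryFL, §6 p. 95 REMARK]
[cite: Rogawski1990, §4.9 Lemma 4.9.3 p. 61; §12.6 p. 174] -/
theorem exists_ncard_selfDualStable_scalarReduction_antidiagTwo_eq_sum_at (hunr : Algebra.IsUnramifiedIn (𝓞 L) v.asIdeal)
    {γ P : GL (Fin 2) (w.1.adicCompletion L)} {u : Fin 2 → w.1.adicCompletion L}
    (hγ : γ ∈ Literature.AlgebraicGeometry.ShimuraVarieties.unitaryGroup (galAdicCompletionMap (L := L) (IsCMField.complexConj L) hw)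
      (placeForm (Matrix.of fun i j : Fin 2 => if i.val + j.val + 1 = 2 then (1 : L) else 0) w.1))
    (hP : (γ : Matrix (Fin 2) (Fin 2) (w.1.adicCompletion L)) * P = P * diagonal u) (hu : Function.Injective u)
    (hu1 : ∀ i, galAdicCompletionMap (L := L) (IsCMField.complexConj L) hw (u i) * u i = 1) {N : ℕ} (hN1 : 1 ≤ N)
    (hN : valuation (w.1.adicCompletion L) (u 0 - u 1) =
      valuation (w.1.adicCompletion L) (toPlace v w (HeckeCharacter.uniformizer ↥(maximalRealSubfield L) v : v.adicCompletion ↥(maximalRealSubfield L)) ^ N)) :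
    ∃ e : ℕ, e ≤ 1 ∧
      (Even (WithZero.log (Valued.v (twistGram (galAdicCompletionMap (L := L) (IsCMField.complexConj L) hw)
        (placeForm (Matrix.of fun i j : Fin 2 => if i.val + j.val + 1 = 2 then (1 : L) else 0) w.1) P.val 0 0))) ↔ e = 0) ∧
      {Λ : Submodule 𝒪[w.1.adicCompletion L] (Fin 2 → w.1.adicCompletion L) |
          ((∃ g : GL (Fin 2) (w.1.adicCompletion L),
              (∃ J' ∈ glInt 2 (w.1.adicCompletion L), (J' : Matrix (Fin 2) (Fin 2) (w.1.adicCompletion L)) =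
                formCongr (galAdicCompletionMap (L := L) (IsCMField.complexConj L) hw) g
                  (placeForm (Matrix.of fun i j : Fin 2 => if i.val + j.val + 1 = 2 then (1 : L) else 0) w.1)) ∧
              Λ = Submodule.span 𝒪[w.1.adicCompletion L] (Set.range ((g : Matrix (Fin 2) (Fin 2) (w.1.adicCompletion L)))ᵀ)) ∧
            Λ.map ((Matrix.toLin' ((γ : GL (Fin 2) (w.1.adicCompletion L)) : Matrix (Fin 2) (Fin 2) (w.1.adicCompletion L))).restrictScalars
              𝒪[w.1.adicCompletion L]) = Λ) ∧
          Λ.map ((Matrix.toLin' (((γ : GL (Fin 2) (w.1.adicCompletion L)) : Matrix (Fin 2) (Fin 2) (w.1.adicCompletion L)) - u 1 • 1)).restrictScalars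
              𝒪[w.1.adicCompletion L]) ≤
            Λ.map ((Matrix.toLin' ((toPlace v w (HeckeCharacter.uniformizer ↥(maximalRealSubfield L) v : v.adicCompletion ↥(maximalRealSubfield L))) •
              (1 : Matrix (Fin 2) (Fin 2) (w.1.adicCompletion L)))).restrictScalars 𝒪[w.1.adicCompletion L])}.ncard =
      ∑ j ∈ (range (N - 1 + 1)).filter (fun j => j % 2 = e),
        (if j = 0 then 1 else Nat.card (𝓞 ↥(maximalRealSubfield L) ⧸ v.asIdeal) ^ (j - 1) * (Nat.card (𝓞 ↥(maximalRealSubfield L) ⧸ v.asIdeal) + 1)) := by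
  classical
  have hc1 : IsCMField.complexConj L ≠ 1 := IsCMField.complexConj_ne_one L
  -- the uniformizer, named ONCE (all later bookkeeping uses the local constant `ϖw`)
  have hϖ0' : (toPlace v w (HeckeCharacter.uniformizer ↥(maximalRealSubfield L) v : v.adicCompletion ↥(maximalRealSubfield L))) ≠ 0 := toPlace_uniformizer_ne_zero L v w hunr
  have hvϖ' : Valued.v (toPlace v w (HeckeCharacter.uniformizer ↥(maximalRealSubfield L) v : v.adicCompletion ↥(maximalRealSubfield L))) = WithZero.exp (-1 : ℤ) := valued_toPlace_uniformizer L v w hunr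
  obtain ⟨ϖw, hϖw⟩ : ∃ x : w.1.adicCompletion L, x = (toPlace v w (HeckeCharacter.uniformizer ↥(maximalRealSubfield L) v : v.adicCompletion ↥(maximalRealSubfield L))) := ⟨_, rfl⟩
  rw [← hϖw] at hN hϖ0' hvϖ'
  have hϖ0 : ϖw ≠ 0 := hϖ0'
  have hvϖ0 : valuation (w.1.adicCompletion L) ϖw ≠ 0 := (Valuation.ne_zero_iff _).2 hϖ0
  have hvϖ : valuation (w.1.adicCompletion L) ϖw < 1 :=
    (v_lt_one_iff_valuation_lt_one ϖw).1 (by rw [hvϖ', ← WithZero.exp_zero]; exact WithZero.exp_lt_exp.2 (by norm_num))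
  have hϖO : ϖw ∈ 𝒪[w.1.adicCompletion L] := (Valuation.mem_integer_iff _ _).2 hvϖ.le
  have hσv : ∀ x : w.1.adicCompletion L, valuation (w.1.adicCompletion L) ((galAdicCompletionMap (L := L) (IsCMField.complexConj L) hw) x) = valuation (w.1.adicCompletion L) x :=
    fun x => valuation_galAdicCompletionMap_eq (IsCMField.complexConj L) v w hw x
  have hval : ∀ i, valuation (w.1.adicCompletion L) (u i) = 1 := fun i => valuation_eq_one_of_galAdicCompletionMap_mul_self L v w hw (hu1 i)
  have hu1O : u 1 ∈ 𝒪[w.1.adicCompletion L] := (Valuation.mem_integer_iff _ _).2 (hval 1).le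
  have hunit : ∀ x : 𝒪[w.1.adicCompletion L], IsUnit x ↔ valuation (w.1.adicCompletion L) (x : w.1.adicCompletion L) = 1 :=
    fun x => Valuation.Integers.isUnit_iff_valuation_eq_one (Valuation.integer.integers _)
  -- the depth-(N−1) difference `c := ϖ⁻¹ (u₀ − u₁)`: `|c| = |ϖ^{N−1}| ≤ 1`
  have hcv : valuation (w.1.adicCompletion L) (ϖw⁻¹ * (u 0 - u 1)) = valuation (w.1.adicCompletion L) (ϖw ^ (N - 1)) := by
    rw [map_mul, map_inv₀, hN, map_pow, map_pow]
    conv_lhs => rw [show N = (N - 1) + 1 by omega, pow_succ]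
    rw [inv_mul_eq_iff_eq_mul₀ hvϖ0, mul_comm]
  have hcle : valuation (w.1.adicCompletion L) (ϖw⁻¹ * (u 0 - u 1)) ≤ 1 := by rw [hcv, map_pow]; exact pow_le_one₀ zero_le hvϖ.le
  -- (1) an integer `a` with `σ_w a − a` a unit (inert place), made a unit; then a unit `t` with `u₁ + t c` a unit (§1 pigeonhole)
  have hσO : ∀ x : 𝒪[w.1.adicCompletion L], (galAdicCompletionMap (L := L) (IsCMField.complexConj L) hw) x ∈ 𝒪[w.1.adicCompletion L] :=
    mem_integer_galAdicCompletionMap (IsCMField.complexConj L) v w hw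
  obtain ⟨a, ha1, hδa⟩ : ∃ a : w.1.adicCompletion L, valuation (w.1.adicCompletion L) a = 1 ∧
      valuation (w.1.adicCompletion L) ((galAdicCompletionMap (L := L) (IsCMField.complexConj L) hw) a - a) = 1 := by
    obtain ⟨σk, hσk⟩ := exists_residueField_ringHom_galAdicCompletionMap (IsCMField.complexConj L) v w hw
    have hq : Nat.card 𝓀[w.1.adicCompletion L] = Nat.card (𝓞 ↥(maximalRealSubfield L) ⧸ v.asIdeal) ^ 2 :=
      natCard_residueField_eq_sq_of_inert (IsCMField.complexConj L) v hc1 hunr w hw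
    letI : Fintype 𝓀[w.1.adicCompletion L] := Fintype.ofFinite _
    have hq' : Fintype.card 𝓀[w.1.adicCompletion L] = Nat.card (𝓞 ↥(maximalRealSubfield L) ⧸ v.asIdeal) ^ 2 := by rw [← Nat.card_eq_fintype_card, hq]
    obtain ⟨a₀, ha₀⟩ := LocalFields.UnramifiedQuadraticNorm.exists_isUnit_map_sub_of_residueHom_ne (galAdicCompletionMap (L := L) (IsCMField.complexConj L) hw) hσO σk hσk
      (Literature.LinearAlgebra.Matrix.exists_frob_ne hq' σk (residueHom_galAdicCompletionMap_eq_pow (IsCMField.complexConj L) v hc1 hunr w hw σk hσO hσk))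
    have hδ : valuation (w.1.adicCompletion L) ((galAdicCompletionMap (L := L) (IsCMField.complexConj L) hw) (a₀ : w.1.adicCompletion L) - a₀) = 1 := (hunit _).1 ha₀
    rcases eq_or_ne (valuation (w.1.adicCompletion L) (a₀ : w.1.adicCompletion L)) 1 with ha₀1 | ha₀1
    · exact ⟨a₀, ha₀1, hδ⟩
    · have hlt : valuation (w.1.adicCompletion L) (a₀ : w.1.adicCompletion L) < 1 := lt_of_le_of_ne a₀.2 ha₀1
      refine ⟨1 + a₀, by rw [Valuation.map_add_eq_of_lt_left _ (by rw [map_one]; exact hlt), map_one], ?_⟩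
      rw [map_add, map_one, show (1 : w.1.adicCompletion L) + (galAdicCompletionMap (L := L) (IsCMField.complexConj L) hw) a₀ - (1 + a₀) = (galAdicCompletionMap (L := L) (IsCMField.complexConj L) hw) a₀ - a₀ by ring]
      exact hδ
  have hσa1 : valuation (w.1.adicCompletion L) ((galAdicCompletionMap (L := L) (IsCMField.complexConj L) hw) a) = 1 := by rw [hσv, ha1]
  obtain ⟨t, ht, hut⟩ := exists_valuation_add_mul_eq_one (hval 1) hcle ha1 hσa1 hδa
  -- (2) the shifted element `A = u₁•1 + (tϖ⁻¹)•(γ − u₁•1)`: same frame, diagonal `u″ = (u₁ + tϖ⁻¹(u₀−u₁), u₁)`, unit determinant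
  -- (no type ascriptions on matrix terms below: every statement is inferred from ★ lemmas — elaborating the literal matrices is costly here)
  have hAP := scalarShift_mul_eigenframe hP (u 1) (t * ϖw⁻¹)
  have hu''0 : u 1 + t * ϖw⁻¹ * (u 0 - u 1) = u 1 + t * (ϖw⁻¹ * (u 0 - u 1)) := by rw [mul_assoc]
  have hu''1 : u 1 + t * ϖw⁻¹ * (u 1 - u 1) = u 1 := by rw [sub_self, mul_zero, add_zero]
  have hval'' : ∀ i : Fin 2, valuation (w.1.adicCompletion L) (u 1 + t * ϖw⁻¹ * (u i - u 1)) = 1 := by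
    refine Fin.forall_fin_two.2 ⟨?_, ?_⟩
    · rw [hu''0]; exact hut
    · rw [hu''1]; exact hval 1
  have hN'' : valuation (w.1.adicCompletion L) ((u 1 + t * ϖw⁻¹ * (u 0 - u 1)) - (u 1 + t * ϖw⁻¹ * (u 1 - u 1))) =
      valuation (w.1.adicCompletion L) (ϖw ^ (N - 1)) := by
    rw [hu''0, hu''1, add_sub_cancel_left, map_mul, ht, one_mul, hcv]
  have hγdet := congrArg (valuation (w.1.adicCompletion L)) (det_eq_mul_of_mul_eigenframe_two P hP)
  rw [map_mul, hval 0, hval 1, mul_one] at hγdet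
  have hAdet := congrArg (valuation (w.1.adicCompletion L)) (det_eq_mul_of_mul_eigenframe_two P hAP)
  rw [map_mul] at hAdet
  rw [hval'' 0, hval'' 1, mul_one] at hAdet
  have hAdet0 := (Valuation.ne_zero_iff _).1 (hAdet.trans_ne one_ne_zero)
  have hA := Matrix.GeneralLinearGroup.val_mkOfDetNeZero _ hAdet0
  rw [← hA] at hAP hAdet
  -- (3) §1: scalar reduction ⟺ `A`-stability (the literal uniformizer re-enters here)
  subst hϖw
  rw [setOf_selfDualStable_scalarReduction_eq (galAdicCompletionMap (L := L) (IsCMField.complexConj L) hw) hϖ0 hu1O ht hϖO (placeForm (Matrix.of fun i j : Fin 2 => if i.val + j.val + 1 = 2 then (1 : L) else 0) w.1) γ _ hA hγdet hAdet]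
  -- (4) transport with γ's rescaled frame (★ (L5-d1)) and count (★ (L5-d3) without unitarity)
  obtain ⟨cc, D, e, hD, he1, hpar, hform⟩ :=
    exists_rescaling_formCongr_eq_uniformizer_pow_smul_one L v w hw hunr (placeForm_antidiagTwo_hermitian L v w hw)
      (det_placeForm_antidiagTwo_ne_zero_and_even L v w).1 (det_placeForm_antidiagTwo_ne_zero_and_even L v w).2 hγ hP hu hu1
  refine ⟨e, he1, hpar, ?_⟩
  have hγ'' := inv_mul_mul_eq_diagonal_of_eigenframe _ P D hAP hD
  rw [diagonal_eq_fin_two''] at hγ''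
  rw [ncard_selfDualStable_congr (galAdicCompletionMap (L := L) (IsCMField.complexConj L) hw) (placeForm (Matrix.of fun i j : Fin 2 => if i.val + j.val + 1 = 2 then (1 : L) else 0) w.1) _ (P * D), hform, ← zpow_natCast]
  exact ncard_selfDualStable_zpow_smul_one_eq_sum_at_of_valuation_eq_one L v w hw hunr hval'' hN'' he1 _ hγ''

end CM

end UnitaryGroup

end Literature.NumberTheory.Automorphic

end
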